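import Literature.AnabelianGeometry.EtaleTheta.Discharge.Sec1DeltaXModClosureDtpY
import Literature.AnabelianGeometry.EtaleTheta.ZHatLevelDetermination
import Literature.AnabelianGeometry.AbsoluteAnabelian.ZHatCompletionAdicCompleteness
import Literature.AnabelianGeometry.SemiGraphs.TemperedCyclotomic
import HarnessLib

/-!
# [EtTh] §1 p. 12 «(Δ^tp_Y)^ell ≅ Ẑ(1)»: the FACT-LIST reduction `DeltaYEllIsoTate ⟸ DeltaYEllClosureIsoTate`
# (F-0659 ⟸ F-1697) — the tempered Tate twist from the profinite one, by density

Mochizuki, *The étale theta function and its Frobenioid-theoretic manifestations*, Publ. RIMS **45** (2009)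
[EtTh], §1, PRIMS PDF p. 12 (printed 238), last display: "Thus, `(Δ^tp_Y)^ell`, `(Δ^tp_Y)^Θ ≅ Ẑ(1)`"
[cite: MochizukiEtTh2009, §1 p.12].  Layer L2 of the abc-iut cell, seat abc-iut-L2-t7 (gen 3); PROOF-ONLY (no
`def`, no `instance`, no named fact); read-only consumer of abc-iut-L3's frozen `SemiGraphs/TemperedCyclotomic.lean`
(`OncePuncturedTemperedGroup.DeltaYEllIsoTate` = FACT-LIST F-0659: the TEMPERED quotient `(Δ^tp_Y)^ell ⊆ (Π^tp_X)^ell`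
is a Tate twist; `DeltaYEllClosureIsoTate` = F-1697: the CLOSURE of the image of `Δ^tp_Y` in `Δ^ell_X` is a Tate
twist).  Sequel of `Sec1DeltaEllExtensionOfClosure.lean` (F-0657 ⟸ F-1697): after this file the [EtTh] p. 12
package for `Δ^ell` — {F-0657, F-0659} — hangs on the single fact F-1697.

For EVERY `D : OncePuncturedTemperedGroup K` (no origin binder):
* `DeltaEllZHat.eta_eq_one_imp` — `η : ℤ → Ẑ` is injective (`η(k) = 1 ⇒ k = 0`);
* `DeltaEllZHat.ellKer_le_deltaY` — `Ker(Π^tp_X ↠ (Π^tp_X)^ell) ≤ Δ^tp_Y` (the profinite completion `Λ` of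
  `Π^tp_X ↠ Z` kills `[Δ_X,Δ_X]⁻`);
* `DeltaEllZHat.isOpenMap_subgroupMap_mk` — generic: for a normal `N ≤ A` with `A` CLOSED in a topological
  group `G`, the restricted quotient map `A → A·N/N ⊆ G/N` is OPEN onto its image (subspace topology);
* `DeltaEllZHat.deltaYEllIsoTate_of_deltaYEllClosureIsoTate` — **F-0659 ⟸ F-1697 for every origin `Ω`**:
  the comparison `(Δ^tp_Y)^ell → Δ^ell_X`, `[δ] ↦ [ι δ]`, is an injective `Π^tp_X`-equivariant homomorphism with
  DENSE image in the closure `T`; the Tate-twist levels `ι_n : T ↠ μ_n` pull back to `(Δ^tp_Y)^ell`: onto `μ_n`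
  by density in the open cosets of `Ker ι_n`, open kernels by the open-map lemma, jointly injective by
  injectivity, equivariant by `conjPiEll`/`conjDeltaEll` compatibility.

HONEST FRAMING: [EtTh] is refereed; the L3 interface is DATA quoting print, asserted for no curve; the Tate
twist itself (F-1697) is NOT proved here; nothing bears on [IUTchIII] Cor. 3.12; typed ≠ proved elsewhere; no side
is taken on any disputed claim.
-/

noncomputable section

namespace Literature.AnabelianGeometry.EtaleTheta

open Literature.AnabelianGeometry.SemiGraphs
open Literature.AnabelianGeometry.AbsoluteAnabelian
open _root_.Topology
open scoped commutatorElement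
open CategoryTheory ProfiniteGrp ProfiniteGrp.ProfiniteCompletion

namespace DeltaEllZHat

universe u

/-! ### Two generic lemmas -/

/-- `η : ℤ → Ẑ` is injective: `η(k) = 1` forces `k ≡ 0 (mod n)` for every `n ≥ 1` ([EtTh] p. 12: `Z ≅ ℤ` embeds
in its profinite completion). [cite: MochizukiEtTh2009, §1 p.12] -/
theorem eta_eq_one_imp {k : ℤ} (h : ZHatLevel.eta k = 1) : k = 0 := by
  have hlev : ZHatLevel.level (Nat.succPNat k.natAbs) (ZHatLevel.eta k) = 1 := by rw [h, map_one]
  rw [ZHatLevel.level_eta, ← ofAdd_zero, Multiplicative.ofAdd.injective.eq_iff,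
    ZMod.intCast_zmod_eq_zero_iff_dvd] at hlev
  refine Int.eq_zero_of_dvd_of_natAbs_lt_natAbs hlev ?_
  rw [Int.natAbs_natCast]
  exact Nat.lt_succ_self _

/-- **Restricted quotient maps are open.**  For a normal subgroup `N` of a topological group `G` and a CLOSED
subgroup `A ⊇ N`, the homomorphism `A → A/N = (A·N)/N ⊆ G/N` (Mathlib's `subgroupMap`, subspace topologies) is an
open map: the image of `A ∩ V` is the trace on `A/N` of the open set `(V ∪ Aᶜ)·N/N` (bookkeeping for the
tempered quotient `(Δ^tp_Y)^ell ⊆ (Π^tp_X)^ell`, [EtTh] p. 12). [cite: MochizukiEtTh2009, §1 p.12] -/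
theorem isOpenMap_subgroupMap_mk {G : Type*} [Group G] [TopologicalSpace G] [IsTopologicalGroup G]
    (N A : Subgroup G) [N.Normal] (hNA : N ≤ A) (hA : IsClosed (A : Set G)) :
    IsOpenMap ((QuotientGroup.mk' N).subgroupMap A) := by
  intro U hU
  obtain ⟨V, hV, rfl⟩ := isOpen_induced_iff.1 hU
  have himg : ((QuotientGroup.mk' N).subgroupMap A) '' (Subtype.val ⁻¹' V) =
      Subtype.val ⁻¹' ((QuotientGroup.mk : G → G ⧸ N) '' (V ∪ (A : Set G)ᶜ)) := by
    ext ⟨x, hx⟩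
    constructor
    · rintro ⟨⟨a, ha⟩, haV, h⟩
      refine ⟨a, Or.inl haV, ?_⟩
      have h' := congr_arg Subtype.val h
      exact h'
    · rintro ⟨g, hg, hgx⟩
      obtain ⟨a', ha', hx'⟩ := hx
      have hgA : g ∈ A := by
        have h1 : (QuotientGroup.mk a' : G ⧸ N) = QuotientGroup.mk g := hx'.trans hgx.symm
        rw [QuotientGroup.eq] at h1
        have h2 : a'⁻¹ * g ∈ A := hNA h1
        simpa using A.mul_mem ha' h2
      have hgV : g ∈ V := by
        rcases hg with hg | hg
        · exact hg
        · exact absurd hgA hg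
      exact ⟨⟨g, hgA⟩, hgV, Subtype.ext hgx⟩
  rw [himg]
  exact ((QuotientGroup.isOpenMap_coe (N := N)) _ (hV.union hA.isOpen_compl)).preimage continuous_subtype_val

/-! ### The [EtTh] §1 interface -/

variable {K : Type u} [Field K] (D : OncePuncturedTemperedGroup K)

/-- **`Ker(Π^tp_X ↠ (Π^tp_X)^ell) ≤ Δ^tp_Y`** ([EtTh] p. 12: the kernel is induced by `Δ_X ↠ Δ^ell_X`, and
`[Δ_X,Δ_X]⁻` dies in the abelian quotient `Z`): an element of `Δ^tp_X` whose image lies in `[Δ_X,Δ_X]⁻` has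
trivial image in `Z`, since the profinite completion `Λ : Π_X → Ẑ` of `Π^tp_X ↠ Z` kills commutators and
`η : Z → Ẑ` is injective. [cite: MochizukiEtTh2009, §1 p.12] -/
theorem ellKer_le_deltaY : D.ellKer ≤ D.deltaY := by
  intro δ hδ
  refine ⟨hδ.1, ?_⟩
  haveI : T2Space D.PiHat := D.isProfiniteCompletion_toHat.t2Space
  obtain ⟨Λ, hΛ⟩ := ClosureKerZHat.exists_hom_zHat D.isProfiniteCompletion_toHat D.zQuot D.isOpen_ker_zQuot
  have hkerClosed : IsClosed ((Λ.toMonoidHom.ker : Subgroup D.PiHat) : Set D.PiHat) := by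
    have : ((Λ.toMonoidHom.ker : Subgroup D.PiHat) : Set D.PiHat) = Λ ⁻¹' {1} := by
      ext x; simp [MonoidHom.mem_ker]
    rw [this]; exact isClosed_singleton.preimage Λ.continuous
  have hell : D.ellKerHat ≤ Λ.toMonoidHom.ker := by
    refine Subgroup.topologicalClosure_minimal _ ?_ hkerClosed
    rw [Subgroup.commutator_le]
    intro a _ b _
    rw [MonoidHom.mem_ker]
    show Λ ⁅a, b⁆ = 1
    rw [commutatorElement_def, map_mul, map_mul, map_mul, map_inv, map_inv,
      ZHatCompletion.mul_comm (Λ a) (Λ b), mul_inv_cancel_right, mul_inv_cancel]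
  have h1 : Λ (D.toHat δ) = 1 := hell hδ.2
  rw [hΛ δ] at h1
  have h2 : Multiplicative.toAdd (D.zQuot δ) = 0 := eta_eq_one_imp (by
    show etaFn (GrpCat.of (Multiplicative ℤ)) (Multiplicative.ofAdd (Multiplicative.toAdd (D.zQuot δ))) = 1
    rw [ofAdd_toAdd]; exact h1)
  show D.zQuot δ = 1
  rw [← ofAdd_toAdd (D.zQuot δ), h2, ofAdd_zero]

/-- `Δ^tp_Y = Δ^tp_X ∩ Π^tp_Y` is closed in `Π^tp_X` (`G_K` Hausdorff, `Π^tp_Y` open). [cite: MochizukiEtTh2009, §1 p.12] -/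
theorem isClosed_deltaY : IsClosed (D.deltaY : Set D.Pi) := by
  have h1 : IsClosed (D.delta : Set D.Pi) := by
    have : (D.delta : Set D.Pi) = D.aug ⁻¹' {1} := by
      ext g; simp [TemperedArithmeticGroup.mem_delta_iff]
    rw [this]; exact isClosed_singleton.preimage D.aug.continuous
  have h2 : IsClosed (D.piY : Set D.Pi) := D.piY.isClosed_of_isOpen D.isOpen_ker_zQuot
  exact h1.inter h2

/-- **F-0659 ⟸ F-1697** ([EtTh] §1 p. 12, "Thus, `(Δ^tp_Y)^ell` … `≅ Ẑ(1)`"): for every origin binder `Ω`, if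
the closure `T` of the image of `Δ^tp_Y` in `Δ^ell_X` is a `Π^tp_X`-stable Tate twist (`DeltaYEllClosureIsoTate Ω`),
then so is the TEMPERED quotient `(Δ^tp_Y)^ell ⊆ (Π^tp_X)^ell` with its conjugation action
(`DeltaYEllIsoTate Ω`): the comparison `(Δ^tp_Y)^ell ↪ T` is an injective equivariant homomorphism with dense
image, along which the Tate-twist levels pull back. [cite: MochizukiEtTh2009, §1 p.12] -/
theorem deltaYEllIsoTate_of_deltaYEllClosureIsoTate (Ω : TemperedPiOrigin K)
    (h : OncePuncturedTemperedGroup.DeltaYEllClosureIsoTate Ω) :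
    OncePuncturedTemperedGroup.DeltaYEllIsoTate Ω := by
  classical
  intro D hD
  obtain ⟨T, hT, hTc, ⟨ι, h1, h2, h3, h4, h5, h6⟩, hTset⟩ := h D hD
  -- the comparison map `φ : Δ^tp_Y → Δ^ell_X`, `δ ↦ [ι δ]`
  have hmemΔ : ∀ δ : ↥D.deltaY, D.toHat (δ : D.Pi) ∈ D.deltaHat := fun δ =>
    Subgroup.le_topologicalClosure _ ⟨δ, δ.2.1, rfl⟩
  let jΔ : ↥D.deltaY →* ↥D.deltaHat :=
    (D.toHat.toMonoidHom.comp D.deltaY.subtype).codRestrict D.deltaHat hmemΔ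
  let φ : ↥D.deltaY →* D.DeltaEll := (QuotientGroup.mk' (D.ellKerHat.subgroupOf D.deltaHat)).comp jΔ
  have hφ : ∀ δ : ↥D.deltaY, φ δ = QuotientGroup.mk ⟨D.toHat (δ : D.Pi), hmemΔ δ⟩ := fun δ => rfl
  have hφc : Continuous φ := by
    refine (QuotientGroup.continuous_mk (N := D.ellKerHat.subgroupOf D.deltaHat)).comp ?_
    exact (D.toHat.continuous.comp continuous_subtype_val).subtype_mk _
  -- `φ` lands in `T` (its image IS the set whose closure is `T`)
  have hφT : ∀ δ : ↥D.deltaY, φ δ ∈ T := by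
    intro δ
    have : φ δ ∈ (T : Set D.DeltaEll) := by
      rw [hTset]
      exact subset_closure ⟨⟨(δ : D.Pi), δ.2.1⟩, δ.2.2, rfl⟩
    exact this
  let jT : ↥D.deltaY →* ↥T := φ.codRestrict T hφT
  have hjT : ∀ δ, ((jT δ : ↥T) : D.DeltaEll) = φ δ := fun δ => rfl
  have hjTc : Continuous jT := hφc.subtype_mk _
  have hjTdense : DenseRange jT := by
    rw [DenseRange, Topology.IsInducing.subtypeVal.dense_iff]
    rintro ⟨x, hx⟩
    have hx' : x ∈ (T : Set D.DeltaEll) := hx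
    rw [hTset] at hx'
    refine closure_mono ?_ hx'
    rintro _ ⟨δ, hδ, rfl⟩
    exact ⟨jT ⟨δ, δ.2, hδ⟩, ⟨⟨δ, δ.2, hδ⟩, rfl⟩, rfl⟩
  -- `φ`/`jT` kill exactly `Ker(Π^tp_X ↠ (Π^tp_X)^ell) ∩ Δ^tp_Y`
  have hφone : ∀ δ : ↥D.deltaY, φ δ = 1 ↔ (δ : D.Pi) ∈ D.ellKer := by
    intro δ
    rw [hφ, QuotientGroup.eq_one_iff, Subgroup.mem_subgroupOf]
    exact ⟨fun hh => ⟨δ.2.1, hh⟩, fun hh => hh.2⟩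
  -- the restricted quotient map `s : Δ^tp_Y ↠ (Δ^tp_Y)^ell`
  let s : ↥D.deltaY →* ↥D.deltaYEll := (QuotientGroup.mk' D.ellKer).subgroupMap D.deltaY
  have hs : Function.Surjective s := MonoidHom.subgroupMap_surjective _ _
  have hsval : ∀ δ : ↥D.deltaY, ((s δ : ↥D.deltaYEll) : D.PiEll) = QuotientGroup.mk (δ : D.Pi) := fun δ => rfl
  have hsone : ∀ δ : ↥D.deltaY, s δ = 1 ↔ (δ : D.Pi) ∈ D.ellKer := by
    intro δ
    rw [← Subtype.coe_inj, hsval, OneMemClass.coe_one, QuotientGroup.eq_one_iff]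
  have hsopen : IsOpenMap s := isOpenMap_subgroupMap_mk D.ellKer D.deltaY (ellKer_le_deltaY D) (isClosed_deltaY D)
  -- descent of `ι_n ∘ jT` along `s`
  have hle : ∀ n, s.ker ≤ ((ι n).comp jT).ker := by
    intro n δ hδ
    rw [MonoidHom.mem_ker] at hδ ⊢
    have hj : jT δ = 1 := Subtype.ext (by rw [hjT]; exact (hφone δ).2 ((hsone δ).1 hδ))
    rw [MonoidHom.comp_apply, hj, map_one]
  let e : ↥D.deltaY ⧸ s.ker ≃* ↥D.deltaYEll := QuotientGroup.quotientKerEquivOfSurjective s hs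
  have he : ∀ δ, e (QuotientGroup.mk δ) = s δ := fun δ => QuotientGroup.kerLift_mk s δ
  have he' : ∀ δ, e.symm (s δ) = QuotientGroup.mk δ := fun δ => by
    rw [MulEquiv.symm_apply_eq]; exact (he δ).symm
  let ι' : ℕ → (↥D.deltaYEll →* (AlgebraicClosure K)ˣ) := fun n =>
    (QuotientGroup.lift s.ker ((ι n).comp jT) (hle n)).comp e.symm.toMonoidHom
  have hι' : ∀ n δ, ι' n (s δ) = ι n (jT δ) := by
    intro n δ
    show QuotientGroup.lift s.ker ((ι n).comp jT) (hle n) (e.symm (s δ)) = _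
    rw [he', QuotientGroup.lift_mk, MonoidHom.comp_apply]
  refine ⟨ι', ?_, ?_, ?_, ?_, ?_, ?_⟩
  · -- values in `μ_n`
    intro n hn t
    obtain ⟨δ, rfl⟩ := hs t
    rw [hι']; exact h1 n hn _
  · -- onto `μ_n`: density of `jT(Δ^tp_Y)` in the open coset `ι_n⁻¹(ζ)`
    intro n hn ζ hζ
    obtain ⟨t', ht'⟩ := h2 n hn ζ hζ
    have hUo : IsOpen {t : ↥T | t'⁻¹ * t ∈ (ι n).ker} :=
      (h3 n hn).preimage (by fun_prop)
    obtain ⟨δ, hδ⟩ := hjTdense.exists_mem_open hUo ⟨t', by simp [MonoidHom.mem_ker]⟩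
    refine ⟨s δ, ?_⟩
    rw [hι']
    have hδ' : ι n (t'⁻¹ * jT δ) = 1 := hδ
    rw [map_mul, map_inv, inv_mul_eq_one] at hδ'
    rw [← hδ', ht']
  · -- open kernels: `Ker ι'_n = s(jT⁻¹ Ker ι_n)`, and `s` is open
    intro n hn
    have hK : (((ι' n).ker : Subgroup ↥D.deltaYEll) : Set ↥D.deltaYEll) = s '' (jT ⁻¹' ((ι n).ker : Set ↥T)) := by
      ext t
      constructor
      · intro ht
        obtain ⟨δ, rfl⟩ := hs t
        refine ⟨δ, ?_, rfl⟩
        have ht' : ι' n (s δ) = 1 := ht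
        rw [hι'] at ht'
        exact ht'
      · rintro ⟨δ, hδ, rfl⟩
        show ι' n (s δ) = 1
        rw [hι']; exact hδ
    rw [hK]
    exact hsopen _ ((h3 n hn).preimage hjTc)
  · -- compatibility
    intro n m hn hm t
    obtain ⟨δ, rfl⟩ := hs t
    rw [hι', hι']; exact h4 n m hn hm _
  · -- joint injectivity
    intro t ht
    obtain ⟨δ, rfl⟩ := hs t
    have hj : jT δ = 1 := h5 _ fun n hn => by rw [← hι']; exact ht n hn
    have hφ1 : φ δ = 1 := by rw [← hjT, hj]; rfl
    exact (hsone δ).2 ((hφone δ).1 hφ1)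
  · -- equivariance under `Π^tp_X`
    intro n hn g t
    obtain ⟨δ, rfl⟩ := hs t
    haveI : D.deltaY.Normal := by
      show (D.delta ⊓ D.piY).Normal; infer_instance
    have hmem : g * (δ : D.Pi) * g⁻¹ ∈ D.deltaY := Subgroup.Normal.conj_mem inferInstance _ δ.2 g
    -- the conjugate of `s δ` is `s (g δ g⁻¹)`
    have hconj : (⟨D.conjPiEll g (s δ : D.PiEll), D.conjPiEll_mem_deltaYEll g (s δ).2⟩ : ↥D.deltaYEll) =
        s ⟨g * (δ : D.Pi) * g⁻¹, hmem⟩ := by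
      apply Subtype.ext
      show D.conjPiEll g (s δ : D.PiEll) = (s ⟨g * (δ : D.Pi) * g⁻¹, hmem⟩ : D.PiEll)
      rw [hsval, hsval]
      rfl
    -- and `jT (g δ g⁻¹)` is the conjugate of `jT δ` in `T`
    have hconjT : jT ⟨g * (δ : D.Pi) * g⁻¹, hmem⟩ =
        ⟨D.conjDeltaEll g (jT δ : D.DeltaEll), hT g _ (jT δ).2⟩ := by
      apply Subtype.ext
      rw [hjT, hφ]
      show _ = D.conjDeltaEll g (φ δ)
      rw [hφ]
      show (QuotientGroup.mk _ : D.DeltaEll) = QuotientGroup.mk (D.conjDeltaHat g ⟨D.toHat (δ : D.Pi), hmemΔ δ⟩)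
      congr 1
      apply Subtype.ext
      rw [OncePuncturedTemperedGroup.coe_conjDeltaHat]
      show D.toHat (g * (δ : D.Pi) * g⁻¹) = _
      rw [map_mul, map_mul, map_inv]
    rw [hconj, hι', hι', hconjT]
    exact h6 n hn g (jT δ)

end DeltaEllZHat

end Literature.AnabelianGeometry.EtaleTheta

end
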